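import Summits.NavierStokesRegularity.NavierStokesRegularity.Theorems.AxisTwistDoorAveragedConeLiouvilleDefs
import Literature.Analysis.FluidPDE.CKNOneScaleOscillation
import Literature.Analysis.FluidPDE.SuitableWeakRescaling
import Literature.Analysis.FluidPDE.LocalTypeIReverseTools
import Literature.Analysis.FluidPDE.SereginSverakPressureDecayBalls
import Literature.Analysis.FluidPDE.LocalTypeILscPressure
import Literature.Analysis.FluidPDE.LocalTypeIProofs
import HarnessLib

/-!
# Route `AxisTwistDoor`, crux `AveragedConeLiouville` (stmt-NavierStokesRegularity-26889), line `lrt_shell` v4: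
# the ANALYTIC CORE of the bridge stub `stub_shellOfLeiRen : ShellFactOfLeiRen`

Width seat ns-in-wu-341 g2 under LEAD ns-atd-p1 (director-ns inputs-12); brick announced on pub/ideators/INBOX.md
(2026-08-28T09:5xZ).  The bridge `ShellFactOfLeiRen` (typed Lei–Ren fact → class-specialised `ShellFact`) was split
by ns-cas-k2 (brick C5, `shellFact_of_leiRen_of_core`) into pure bookkeeping PLUS one analytic hypothesis `hcore`;
this file proves `hcore` verbatim:

* `shellCore_of_class` — for every bound `I₀ < ∞` there is `G₀ > 0` such that every profile of the route's energy
  class `InClass C v π H` with Albritton–Barker quantity `𝐈 ≤ I₀` admits a pressure `π'` (the ball-mean normalisation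
  `π' = π − ⨍_{B(0,2)} π(t,·)`, critic L1) for which `(v, π')` is a suitable weak solution in Lei–Ren's round
  cylinder `𝓠(1)` in the sense `LeiRen2024.IsSuitableWeakSolutionInCyl 1 v π'` and
  `∫_{𝓠(1)} (|v|³ + |π'|^{3/2}) + 2 ≤ G₀` (namely `G₀ = 12·I₀ + 2`).

Mechanism (all tree lemmas): `IsSuitableWeakSolutionOn.sub_ballMean_slab` (normalising the pressure by a ball mean
keeps suitability on the slab) and `.of_le` (restriction to the open cylinder `𝓠(1) ⊆ Q((0,0),2) ⊆ (−∞,0) × ℝ³`);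
the four masses are read off `A + C + D_osc + E ≤ 𝐈 ≤ I₀` at the parabolic ball `Q((0,0), 2)`
(`abScaledSum_le_typeIBound`, `cknAEss/cknC/cknDOsc/cknE_le_abScaledSum`), the oscillation quantity being the raw
pressure quantity of the normalised pressure.  [cite: AlbrittonBarker2019, §1 (𝐈); LeiRenTian2025, Lemma 2.4
(arXiv:2501.08976, p. 7); CaffarelliKohnNirenberg1982, §2]

WHAT THIS IS NOT: not a statement about Navier–Stokes regularity; the door statements concern HYPOTHETICAL blow-up
profiles; `AveragedConeLiouville`, item 26889 and the summit are OPEN and untouched by this file.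
-/

noncomputable section

-- the summit and its single sub-problem share the name (CONVENTIONS §1)
set_option linter.dupNamespace false

namespace Summit.NavierStokesRegularity.NavierStokesRegularity.Theorems.AveragedConeLiouville.ShellCore

open scoped ENNReal NNReal Topology
open MeasureTheory Set Function Filter Metric
open Literature.Analysis Literature.Analysis.FluidPDE
open Summit.NavierStokesRegularity.NavierStokesRegularity.Theorems.AxisTwistDoorAveragedConeLiouvilleDefs

/-- Lei–Ren's round cylinder `𝓠(1) = (−1,0) × {ϱ < 1, |x₃| < 1}` sits inside Albritton–Barker's parabolic ball
`Q((0,0), 2) = (−4,0) × B(0,2)`. [folklore] -/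
theorem parCyl_one_subset_parabolicCylinder_two :
    SereginSverak2009.parCyl (0 : ℝ × EuclideanSpace ℝ (Fin 3)) 1 ⊆
      parabolicCylinder 2 (0 : ℝ × EuclideanSpace ℝ (Fin 3)) := by
  intro w hw
  rw [SereginSverak2009.mem_parCyl_zero] at hw
  obtain ⟨⟨h1, h2⟩, h3, h4⟩ := hw
  rw [mem_parabolicCylinder]
  refine ⟨⟨by simp only [Prod.fst_zero]; linarith, by simpa using h2⟩, ?_⟩
  have hx : w.2 ∈ ball (0 : EuclideanSpace ℝ (Fin 3)) (2 * 1) :=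
    SereginSverak2009.spaceCyl_subset_ball 0 1 ((SereginSverak2009.mem_spaceCyl).2 (by simpa using ⟨h3, h4⟩))
  simpa [Prod.snd_zero] using hx

/-- Lei–Ren's space cylinder `{ϱ < 1, |x₃| < 1}` sits inside the ball `B(0,2)`. [folklore] -/
theorem spaceCyl_one_subset_ball_two :
    SereginSverak2009.spaceCyl (0 : EuclideanSpace ℝ (Fin 3)) 1 ⊆ ball (0 : EuclideanSpace ℝ (Fin 3)) 2 := by
  have h := SereginSverak2009.spaceCyl_subset_ball (0 : EuclideanSpace ℝ (Fin 3)) (1 : ℝ)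
  simpa using h

/-- `𝓠(1)` lies in the open backward slab `(−∞, 0) × ℝ³`. [folklore] -/
theorem parCylOpens_one_le_slab :
    SereginSverak2009.parCylOpens (0 : ℝ × EuclideanSpace ℝ (Fin 3)) 1 ≤
      slab (EuclideanSpace ℝ (Fin 3)) (Set.Iio (0 : ℝ)) isOpen_Iio := by
  intro w hw
  have hw' : w ∈ SereginSverak2009.parCyl (0 : ℝ × EuclideanSpace ℝ (Fin 3)) 1 := hw
  rw [SereginSverak2009.mem_parCyl_zero] at hw'
  exact mem_slab.2 hw'.1.2

/-- `Q((0,0),2)` lies in the backward half space `(−∞,0) × ℝ³` (as a set). [folklore] -/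
theorem parabolicCylinder_two_subset_halfSpace :
    parabolicCylinder 2 (0 : ℝ × EuclideanSpace ℝ (Fin 3)) ⊆ Set.Iio (0 : ℝ) ×ˢ (Set.univ : Set (EuclideanSpace ℝ (Fin 3))) := by
  intro w hw
  rw [mem_parabolicCylinder] at hw
  exact ⟨by simpa using hw.1.2, mem_univ _⟩

/-- **The analytic core of the Lei–Ren bridge** (module docstring): uniform `G₀ = G₀(I₀)` such that every class
profile with `𝐈 ≤ I₀` is, after the ball-mean normalisation of its pressure, a suitable weak solution in Lei–Ren's
round cylinder `𝓠(1)` with `∫_{𝓠(1)}(|v|³ + |π'|^{3/2}) + 2 ≤ G₀`.  This is EXACTLY the hypothesis `hcore` of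
ns-cas-k2's bookkeeping brick `shellFact_of_leiRen_of_core`.
[cite: AlbrittonBarker2019, §1; LeiRenTian2025, Lemma 2.4; CaffarelliKohnNirenberg1982, §2] -/
theorem shellCore_of_class :
    ∀ I₀ : ℝ≥0∞, I₀ < ⊤ → ∃ G₀ : ℝ, 0 < G₀ ∧ ∀ C v π H, InClass C v π H →
      typeIBound (Set.Iio 0 ×ˢ Set.univ) v π H ≤ I₀ →
        ∃ π', LeiRen2024.IsSuitableWeakSolutionInCyl 1 v π' ∧
          (∫⁻ z in SereginSverak2009.parCyl 0 1, (‖v z.1 z.2‖ₑ ^ (3:ℕ) + ‖π' z.1 z.2‖ₑ ^ (3/2:ℝ))) + 2 ≤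
            ENNReal.ofReal G₀ := by
  intro I₀ hI₀
  refine ⟨12 * I₀.toReal + 2, by positivity, ?_⟩
  intro C v π H hcl hI
  -- the normalised pressure
  set π' : ℝ → EuclideanSpace ℝ (Fin 3) → ℝ :=
    fun t x => π t x - ⨍ y in ball (0 : EuclideanSpace ℝ (Fin 3)) 2, π t y with hπ'
  refine ⟨π', ?_, ?_⟩
  · -- ### suitability in Lei–Ren's cylinder
    have hsw' : IsSuitableWeakSolutionOn (slab (EuclideanSpace ℝ (Fin 3)) (Set.Iio (0 : ℝ)) isOpen_Iio) 1 0 v π' :=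
      hcl.suitable.sub_ballMean_slab (0 : EuclideanSpace ℝ (Fin 3)) (r := 2) two_pos
    have hcyl : IsSuitableWeakSolutionOn (SereginSverak2009.parCylOpens (0 : ℝ × EuclideanSpace ℝ (Fin 3)) 1) 1 0 v π' :=
      hsw'.of_le parCylOpens_one_le_slab
    -- the four scaled quantities at the parabolic ball `Q((0,0),2)`
    have hQ2 : parabolicCylinder 2 (0 : ℝ × EuclideanSpace ℝ (Fin 3)) ⊆
        Set.Iio (0 : ℝ) ×ˢ (Set.univ : Set (EuclideanSpace ℝ (Fin 3))) := parabolicCylinder_two_subset_halfSpace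
    have hS : abScaledSum 2 0 v π H ≤ I₀ := (abScaledSum_le_typeIBound two_pos hQ2).trans hI
    have hA : cknAEss 2 0 v ≤ I₀ := cknAEss_le_abScaledSum.trans hS
    have hE : cknE 2 (0 : ℝ × EuclideanSpace ℝ (Fin 3)) H ≤ I₀ := cknE_le_abScaledSum.trans hS
    have h2 : (ENNReal.ofReal 2) ≠ 0 := by simp
    have h2' : (ENNReal.ofReal 2) ≠ ∞ := ENNReal.ofReal_ne_top
    refine ⟨hcyl, ?_, ?_, ?_⟩
    · -- slice `L²` bound, a.e. in `t ∈ (−1, 0)`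
      refine ⟨(ENNReal.ofReal 2 * I₀).toNNReal, ?_⟩
      have hco : ((ENNReal.ofReal 2 * I₀).toNNReal : ℝ≥0∞) = ENNReal.ofReal 2 * I₀ :=
        ENNReal.coe_toNNReal (ENNReal.mul_ne_top h2' hI₀.ne)
      have hae : ∀ᵐ t ∂(volume.restrict (Ioo ((0 : ℝ × EuclideanSpace ℝ (Fin 3)).1 - 2 ^ 2) (0 : ℝ × EuclideanSpace ℝ (Fin 3)).1)),
          (ENNReal.ofReal 2)⁻¹ * ∫⁻ x in ball (0 : ℝ × EuclideanSpace ℝ (Fin 3)).2 2, ‖v t x‖ₑ ^ 2 ≤ I₀ := by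
        filter_upwards [ENNReal.ae_le_essSup fun t : ℝ =>
          (ENNReal.ofReal 2)⁻¹ * ∫⁻ x in ball (0 : ℝ × EuclideanSpace ℝ (Fin 3)).2 2, ‖v t x‖ₑ ^ 2] with t ht
        exact ht.trans hA
      have hae' : ∀ᵐ t ∂(volume.restrict (Ioo (-(4 : ℝ)) 0)),
          ∫⁻ x in ball (0 : EuclideanSpace ℝ (Fin 3)) 2, ‖v t x‖ₑ ^ 2 ≤ ENNReal.ofReal 2 * I₀ := by
        have hset : Ioo ((0 : ℝ × EuclideanSpace ℝ (Fin 3)).1 - 2 ^ 2) (0 : ℝ × EuclideanSpace ℝ (Fin 3)).1 =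
            Ioo (-(4 : ℝ)) 0 := by norm_num
        rw [hset] at hae
        filter_upwards [hae] with t ht
        exact SuitableCompactness.le_mul_of_inv_mul_le h2 h2' (by simpa using ht)
      have hsub : Ioo (-(1 : ℝ) ^ 2) 0 ⊆ Ioo (-(4 : ℝ)) 0 := by
        intro t ht; exact ⟨by norm_num at ht ⊢; linarith [ht.1], ht.2⟩
      filter_upwards [ae_restrict_of_ae_restrict_of_subset hsub hae'] with t ht
      rw [hco]
      exact (lintegral_mono_set spaceCyl_one_subset_ball_two).trans ht
    · -- weak gradient with finite Dirichlet mass on `𝓠(1)`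
      refine ⟨H, hcl.weakGrad.mono parCylOpens_one_le_slab, ?_⟩
      have hEm : ∫⁻ q in parabolicCylinder 2 (0 : ℝ × EuclideanSpace ℝ (Fin 3)),
          ENNReal.ofReal (frobeniusNormSq (H q.1 q.2)) ≤ ENNReal.ofReal 2 * I₀ := by
        refine SuitableCompactness.le_mul_of_inv_mul_le h2 h2' ?_
        simpa [cknE] using hE
      refine lt_of_le_of_lt ((lintegral_mono_set parCyl_one_subset_parabolicCylinder_two).trans hEm) ?_
      exact ENNReal.mul_lt_top ENNReal.ofReal_lt_top hI₀
    · -- `π' ∈ L^{3/2}(𝓠(1))`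
      obtain ⟨h32, h32', h32r⟩ := threeHalves_facts
      have hli : LocallyIntegrableOn (uncurry π')
          ((slab (EuclideanSpace ℝ (Fin 3)) (Set.Iio (0 : ℝ)) isOpen_Iio : Set (ℝ × EuclideanSpace ℝ (Fin 3)))) volume :=
        hsw'.distributional.2.2.1
      have hm : AEStronglyMeasurable (uncurry π')
          (volume.restrict (SereginSverak2009.parCyl (0 : ℝ × EuclideanSpace ℝ (Fin 3)) 1)) :=
        hli.aestronglyMeasurable.mono_measure (Measure.restrict_mono parCylOpens_one_le_slab le_rfl)
      refine ⟨hm, ?_⟩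
      rw [eLpNorm_lt_top_iff_lintegral_rpow_enorm_lt_top (zero_lt_one.trans_le h32).ne' h32', h32r]
      have hD : cknDOsc 2 0 π ≤ I₀ := cknDOsc_le_abScaledSum.trans hS
      have hDm : ∫⁻ w in parabolicCylinder 2 (0 : ℝ × EuclideanSpace ℝ (Fin 3)), ‖π' w.1 w.2‖ₑ ^ (3 / 2 : ℝ) ≤
          ENNReal.ofReal 2 ^ 2 * I₀ := by
        refine SuitableCompactness.le_mul_of_inv_mul_le (pow_ne_zero _ h2) (ENNReal.pow_ne_top h2') ?_
        simpa [cknDOsc, hπ'] using hD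
      refine lt_of_le_of_lt ((lintegral_mono_set parCyl_one_subset_parabolicCylinder_two).trans hDm) ?_
      exact ENNReal.mul_lt_top (ENNReal.pow_lt_top ENNReal.ofReal_lt_top) hI₀
  · -- ### the mass bound `∫_{𝓠(1)}(|v|³ + |π'|^{3/2}) + 2 ≤ 12 I₀ + 2`
    have hQ2 : parabolicCylinder 2 (0 : ℝ × EuclideanSpace ℝ (Fin 3)) ⊆
        Set.Iio (0 : ℝ) ×ˢ (Set.univ : Set (EuclideanSpace ℝ (Fin 3))) := parabolicCylinder_two_subset_halfSpace
    have hS : abScaledSum 2 0 v π H ≤ I₀ := (abScaledSum_le_typeIBound two_pos hQ2).trans hI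
    have h2 : (ENNReal.ofReal 2) ≠ 0 := by simp
    have h2' : (ENNReal.ofReal 2) ≠ ∞ := ENNReal.ofReal_ne_top
    have h22 : ENNReal.ofReal 2 ^ 2 = 4 := by
      rw [ENNReal.ofReal_ofNat]; norm_num
    -- cubic mass
    have hC : cknC 2 (0 : ℝ × EuclideanSpace ℝ (Fin 3)) v ≤ I₀ := cknC_le_abScaledSum.trans hS
    have hCm : ∫⁻ w in parabolicCylinder 2 (0 : ℝ × EuclideanSpace ℝ (Fin 3)), ‖v w.1 w.2‖ₑ ^ (3 : ℕ) ≤ 4 * I₀ := by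
      rw [← h22]
      refine SuitableCompactness.le_mul_of_inv_mul_le (pow_ne_zero _ h2) (ENNReal.pow_ne_top h2') ?_
      simpa [cknC] using hC
    -- pressure mass
    have hD : cknDOsc 2 0 π ≤ I₀ := cknDOsc_le_abScaledSum.trans hS
    have hDm : ∫⁻ w in parabolicCylinder 2 (0 : ℝ × EuclideanSpace ℝ (Fin 3)), ‖π' w.1 w.2‖ₑ ^ (3 / 2 : ℝ) ≤ 4 * I₀ := by
      rw [← h22]
      refine SuitableCompactness.le_mul_of_inv_mul_le (pow_ne_zero _ h2) (ENNReal.pow_ne_top h2') ?_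
      simpa [cknDOsc, hπ'] using hD
    -- measurability of the cubic integrand (continuity of the class profile on the open slab)
    have hvm : AEMeasurable (fun z : ℝ × EuclideanSpace ℝ (Fin 3) => ‖v z.1 z.2‖ₑ ^ (3 : ℕ))
        (volume.restrict (SereginSverak2009.parCyl (0 : ℝ × EuclideanSpace ℝ (Fin 3)) 1)) := by
      have hc : ContinuousOn (uncurry v) (SereginSverak2009.parCyl (0 : ℝ × EuclideanSpace ℝ (Fin 3)) 1) :=
        hcl.cont.mono fun w hw => parCylOpens_one_le_slab hw
      exact ((hc.aestronglyMeasurable (SereginSverak2009.isOpen_parCyl _ _).measurableSet).aemeasurable.enorm.pow_const _)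
    rw [lintegral_add_left' hvm]
    have h1 : ∫⁻ z in SereginSverak2009.parCyl (0 : ℝ × EuclideanSpace ℝ (Fin 3)) 1, ‖v z.1 z.2‖ₑ ^ (3 : ℕ) ≤ 4 * I₀ :=
      (lintegral_mono_set parCyl_one_subset_parabolicCylinder_two).trans hCm
    have h3 : ∫⁻ z in SereginSverak2009.parCyl (0 : ℝ × EuclideanSpace ℝ (Fin 3)) 1, ‖π' z.1 z.2‖ₑ ^ (3 / 2 : ℝ) ≤ 4 * I₀ :=
      (lintegral_mono_set parCyl_one_subset_parabolicCylinder_two).trans hDm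
    have hI₀' : I₀ = ENNReal.ofReal I₀.toReal := (ENNReal.ofReal_toReal hI₀.ne).symm
    calc (∫⁻ z in SereginSverak2009.parCyl (0 : ℝ × EuclideanSpace ℝ (Fin 3)) 1, ‖v z.1 z.2‖ₑ ^ (3 : ℕ)) +
          (∫⁻ z in SereginSverak2009.parCyl (0 : ℝ × EuclideanSpace ℝ (Fin 3)) 1, ‖π' z.1 z.2‖ₑ ^ (3 / 2 : ℝ)) + 2
        ≤ 4 * I₀ + 4 * I₀ + 2 := by gcongr
      _ ≤ ENNReal.ofReal (12 * I₀.toReal + 2) := by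
        rw [hI₀', ENNReal.toReal_ofReal ENNReal.toReal_nonneg]
        rw [show (4 : ℝ≥0∞) = ENNReal.ofReal 4 by norm_num, show (2 : ℝ≥0∞) = ENNReal.ofReal 2 by norm_num,
          ← ENNReal.ofReal_mul (by norm_num), ← ENNReal.ofReal_add (by positivity) (by positivity),
          ← ENNReal.ofReal_add (by positivity) (by norm_num)]
        exact ENNReal.ofReal_le_ofReal (by nlinarith [ENNReal.toReal_nonneg (a := I₀)])

end Summit.NavierStokesRegularity.NavierStokesRegularity.Theorems.AveragedConeLiouville.ShellCore

end
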